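import Summits.HodgeConjecture.HodgeConjecture.Theorems.HLiu418E2ArchOrthHol
import Summits.HodgeConjecture.HodgeConjecture.Theorems.HLiu418E2OfCuts
import Summits.HodgeConjecture.HodgeConjecture.Theorems.HLiu418S1BettiSliceExclusion
import Literature.AlgebraicGeometry.ShimuraVarieties.HermitianNegConeOrbitDensity
import HarnessLib

/-!
# Crux `HLiu418`, K-lane E₂ — S2⁺₂ CLOSED: `archOrthHol₂_holds`, the body of the cut `ArchOrthHolType₂` in the binder prefix of the letter
# `UnitaryCurveForms.cohIsotypicLine₂_hol`, from the generic disc identity ★ `E2ArchOrthHol.archOrth₂_of_frame`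

Cell `hodgecm-mathlib`, FLOOR 0, programme P5 (`F0_AlbCm`); crux item `stmt-HodgeConjecture-24832`; seat F0P5-p02 (g2),
`--supports stmt-HodgeConjecture-24832` (helper).  THEOREMS ONLY — no definition, no instance, no notation, no `sorry`.

The letter's frame `formCongr c g (t • H) = diag dV` (`dV` real, `t ≠ 0`) makes `σ(t) • σ(H)` HERMITIAN at every complex embedding `σ`
(`σ(t • H) = Pᴴ diag(σ dV) P`, `P = σ(g⁻¹)`), whence the two frame hypotheses of the generic theorem for the cone frame `𝔣` at the place of `ι`:
`⟪v₀, t₀⟫ = 0` (from `⟪t₀, v₀⟫ = 0` by hermitian symmetry of `σ(t)⟪·,·⟫`) and `⟪v₀,v₀⟫ = −r ⟪t₀,t₀⟫` with the REAL `r = −m₁/m₂ > 0`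
(`mᵢ` the real values of `σ(t)⟪v₀,v₀⟫`, `σ(t)⟪t₀,t₀⟫`, of opposite signs by `Re ⟪v₀,v₀⟫ < 0 < Re ⟪t₀,t₀⟫`); the automorphic quotient is compact
because `H` is anisotropic (★ `S1BettiSliceExclusion.anisotropic_of_formCongr_posDef` at a complex place `≠` that of `ι`, which exists as
`4 ≤ [L:ℚ]`, ★ `compactSpace_adelicGroupData_automorphicQuotient`).  Head: **`archOrthHol₂_holds`** = the cut `ArchOrthHolType₂` of the K-E₂ plan
(HOME `F0/P5/p02/KE2/HLiu418E2Cuts…`) TOKEN FOR TOKEN, so `E2OfCuts.cohIsotypicLine₂_hol_of_cuts archOrthHol₂_holds` leaves the named facts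
E₂-hol / E₂-antihol hinging on S3₂ `AdmissibleOfHolValuedType₂` alone: `cohIsotypicLine₂_hol_of_admissible`, `cohIsotypicLine₂_antihol_of_admissible`.
HONEST LABEL: HC_CM is proved only modulo the 7 printed citations until rung 0 closes; this file discharges none of them.

## References
* [Liu2021] App. D Lem. D.2 (2), §D.3.  [BorelWallach2000] VII 3.2.  [Jacobson] N. Jacobson, *Basic Algebra I*, Ch. V §7 (hermitian forms).
-/

set_option autoImplicit false
-- the mandated namespace has the single-problem summit's repeated segment (`HodgeConjecture.HodgeConjecture`)
set_option linter.dupNamespace false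

noncomputable section

open Matrix MeasureTheory NumberField NumberField.InfinitePlace
open scoped Matrix ComplexConjugate ComplexOrder InnerProductSpace
open Literature.NumberTheory.Automorphic Literature.NumberTheory.Automorphic.UnitaryGroup
open Literature.NumberTheory.Automorphic.UnitaryGroup.CotangentForms (toQuotFun)
open Literature.NumberTheory.Automorphic.UnitaryCurveForms
open Literature.AlgebraicGeometry.ShimuraVarieties
open Summit.HodgeConjecture.HodgeConjecture.Cruxes.HLiu418.E2ArchOrthHol
open Summit.HodgeConjecture.HodgeConjecture.Cruxes.HLiu418.E2OfCuts

namespace Summit.HodgeConjecture.HodgeConjecture.Cruxes.HLiu418.E2ArchOrthHolCM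

/-! ## §1 `σ(t • H)` is hermitian; the two frame hypotheses -/

section Frame

variable {L : Type} [Field L] [NumberField L] [IsCMField L]

/-- **`σ(t • H)` is hermitian**: from `formCongr c g (t • H) = diag dV` with `c dV = dV`, at every complex embedding `σ` of the CM field `L`
the matrix `(t • H).map σ` is `Pᴴ · diag(σ dV) · P` with `P = σ(g⁻¹)` and `σ dV` real. [cite: Jacobson, Ch. V §7 pp. 150–151] -/
theorem isHermitian_map_smul (H : Matrix (Fin 2) (Fin 2) L) (dV : Fin 2 → L) (hdV : ∀ i, IsCMField.complexConj L (dV i) = dV i)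
    (t : L) (g : GL (Fin 2) L)
    (hg : formCongr ((IsCMField.complexConj L : L ≃ₐ[↥(maximalRealSubfield L)] L) : L →+* L) g (t • H) = Matrix.diagonal dV)
    (σ : L →+* ℂ) : ((t • H).map σ).IsHermitian := by
  have htH : t • H = formCongr ((IsCMField.complexConj L : L ≃ₐ[↥(maximalRealSubfield L)] L) : L →+* L) g⁻¹ (Matrix.diagonal dV) := by
    rw [← hg, formCongr_inv_formCongr]
  -- `σ ∘ c = conj ∘ σ` on matrices
  have hcomm : ∀ M : Matrix (Fin 2) (Fin 2) L,
      (M.map ((IsCMField.complexConj L : L ≃ₐ[↥(maximalRealSubfield L)] L) : L →+* L)).map σ = (M.map σ).map (starRingEnd ℂ) := by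
    intro M
    ext i j
    simp only [map_apply, RingHom.coe_coe]
    exact IsCMField.complexEmbedding_complexConj L σ (M i j)
  have hD : ((Matrix.diagonal dV).map σ).IsHermitian := by
    rw [diagonal_map (map_zero σ)]
    refine isHermitian_diagonal_of_self_adjoint _ (funext fun i => ?_)
    change star (σ (dV i)) = σ (dV i)
    rw [Complex.star_def, ← IsCMField.complexEmbedding_complexConj L σ (dV i), hdV i]
  rw [htH]
  change ((((((g⁻¹ : GL (Fin 2) L) : Matrix (Fin 2) (Fin 2) L).map _)ᵀ * Matrix.diagonal dV * ((g⁻¹ : GL (Fin 2) L) : Matrix (Fin 2) (Fin 2) L)).map σ)).IsHermitian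
  rw [Matrix.map_mul, Matrix.map_mul, transpose_map, hcomm,
    show ((((g⁻¹ : GL (Fin 2) L) : Matrix (Fin 2) (Fin 2) L).map σ).map (starRingEnd ℂ))ᵀ =
      (((g⁻¹ : GL (Fin 2) L) : Matrix (Fin 2) (Fin 2) L).map σ)ᴴ from Matrix.ext fun _ _ => rfl]
  exact isHermitian_conjTranspose_mul_mul _ hD

omit [NumberField L] [IsCMField L] in
/-- `(t • H).map σ = σ t • H.map σ`. [cite: Jacobson, Ch. V §7 pp. 150–151] -/
theorem map_smul_eq (H : Matrix (Fin 2) (Fin 2) L) (t : L) (σ : L →+* ℂ) : (t • H).map σ = σ t • H.map σ := by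
  ext i j
  simp only [Matrix.map_apply, Matrix.smul_apply, smul_eq_mul, map_mul]

/-- **The two frame hypotheses at the place of `ι`.**  For a cone frame `𝔣` of `H` at `cmPlace L ι` and the letter's frame data:
`⟪v₀, t₀⟫ = 0` and `⟪v₀, v₀⟫ = −r ⟪t₀, t₀⟫` for a real `r > 0` (`⟪x,y⟫ = x̄ᵀ σ(H) y`, `σ` the embedding of the place of `ι`).
[cite: Jacobson, Ch. V §7 pp. 150–151] -/
theorem frame_hypotheses (ι : L →+* ℂ) (H : Matrix (Fin 2) (Fin 2) L) (dV : Fin 2 → L) (hdV : ∀ i, IsCMField.complexConj L (dV i) = dV i)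
    (t : L) (ht : t ≠ 0) (g : GL (Fin 2) L)
    (hg : formCongr ((IsCMField.complexConj L : L ≃ₐ[↥(maximalRealSubfield L)] L) : L →+* L) g (t • H) = Matrix.diagonal dV)
    (𝔣 : ConeFrame L H (cmPlace L ι)) :
    star 𝔣.v₀ ⬝ᵥ (H.map (cmPlace L ι).1.embedding *ᵥ 𝔣.t₀) = 0 ∧
      ∃ r : ℝ, 0 < r ∧ star 𝔣.v₀ ⬝ᵥ (H.map (cmPlace L ι).1.embedding *ᵥ 𝔣.v₀) =
        -(r : ℂ) * (star 𝔣.t₀ ⬝ᵥ (H.map (cmPlace L ι).1.embedding *ᵥ 𝔣.t₀)) := by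
  set σ : L →+* ℂ := (cmPlace L ι).1.embedding with hσ
  have hherm : (σ t • H.map σ).IsHermitian := by rw [← map_smul_eq]; exact isHermitian_map_smul H dV hdV t g hg σ
  have hσt : σ t ≠ 0 := (map_ne_zero σ).2 ht
  -- `σ t ⟪x, y⟫ = x̄ᵀ (σ t • σH) y`
  have hQ' : ∀ x y : Fin 2 → ℂ, star x ⬝ᵥ ((σ t • H.map σ) *ᵥ y) = σ t * (star x ⬝ᵥ (H.map σ *ᵥ y)) := fun x y => by
    rw [smul_mulVec, dotProduct_smul, smul_eq_mul]
  -- hermitian symmetry of `Q'`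
  have hsym : ∀ x y : Fin 2 → ℂ, star (star x ⬝ᵥ ((σ t • H.map σ) *ᵥ y)) = star y ⬝ᵥ ((σ t • H.map σ) *ᵥ x) :=
    fun x y => star_star_dotProduct_mulVec hherm x y
  refine ⟨?_, ?_⟩
  · -- `⟪v₀, t₀⟫ = 0`
    have h1 := hsym 𝔣.t₀ 𝔣.v₀
    rw [hQ', hQ', 𝔣.orth, mul_zero, star_zero] at h1
    exact (mul_eq_zero.1 h1.symm).resolve_left hσt
  · -- the real values `m₁`, `m₂`
    have hreal : ∀ x : Fin 2 → ℂ, star x ⬝ᵥ ((σ t • H.map σ) *ᵥ x) = ((star x ⬝ᵥ ((σ t • H.map σ) *ᵥ x)).re : ℂ) := fun x => by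
      have h := hsym x x
      rw [Complex.star_def] at h
      exact (Complex.conj_eq_iff_re.1 h).symm
    set m₁ : ℝ := (star 𝔣.v₀ ⬝ᵥ ((σ t • H.map σ) *ᵥ 𝔣.v₀)).re with hm₁
    set m₂ : ℝ := (star 𝔣.t₀ ⬝ᵥ ((σ t • H.map σ) *ᵥ 𝔣.t₀)).re with hm₂
    have hv : star 𝔣.v₀ ⬝ᵥ (H.map σ *ᵥ 𝔣.v₀) = (σ t)⁻¹ * m₁ := by
      rw [← hreal, hQ', ← mul_assoc, inv_mul_cancel₀ hσt, one_mul]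
    have htt : star 𝔣.t₀ ⬝ᵥ (H.map σ *ᵥ 𝔣.t₀) = (σ t)⁻¹ * m₂ := by
      rw [← hreal, hQ', ← mul_assoc, inv_mul_cancel₀ hσt, one_mul]
    -- signs: `Re ⟪v₀,v₀⟫ < 0 < Re ⟪t₀,t₀⟫`
    have hneg : ((σ t)⁻¹ * m₁).re < 0 := by rw [← hv]; exact mem_negCone_iff.1 𝔣.v₀_mem
    have hpos : 0 < ((σ t)⁻¹ * m₂).re := by rw [← htt]; exact 𝔣.t₀_pos
    rw [Complex.re_mul_ofReal] at hneg hpos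
    have hm₂ : m₂ ≠ 0 := fun h => by rw [h, mul_zero] at hpos; exact lt_irrefl _ hpos
    have hprod : m₁ * m₂ < 0 := by
      have h1 : ((σ t)⁻¹.re * m₁) * ((σ t)⁻¹.re * m₂) < 0 := mul_neg_of_neg_of_pos hneg hpos
      by_contra h
      push Not at h
      have h2 : 0 ≤ ((σ t)⁻¹.re * m₁) * ((σ t)⁻¹.re * m₂) := by
        rw [show ((σ t)⁻¹.re * m₁) * ((σ t)⁻¹.re * m₂) = ((σ t)⁻¹.re * (σ t)⁻¹.re) * (m₁ * m₂) by ring]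
        exact mul_nonneg (mul_self_nonneg _) h
      exact absurd h1 (not_lt.2 h2)
    refine ⟨-m₁ / m₂, ?_, ?_⟩
    · have : -m₁ / m₂ = -(m₁ * m₂) / m₂ ^ 2 := by field_simp
      rw [this]
      exact div_pos (by linarith) (by positivity)
    · rw [hv, htt]
      have hm₂' : (m₂ : ℂ) ≠ 0 := Complex.ofReal_ne_zero.2 hm₂
      rw [show (((-m₁ / m₂ : ℝ)) : ℂ) = -(m₁ : ℂ) / (m₂ : ℂ) by push_cast; ring]
      field_simp

end Frame

/-! ## §2 The head: `ArchOrthHolType₂` in the letter's binder prefix -/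

/-- **S2⁺₂ CLOSED — `archOrthHol₂_holds`**: the body of the K-E₂ cut `ArchOrthHolType₂` TOKEN FOR TOKEN (binder prefix of ★
`UnitaryCurveForms.cohIsotypicLine₂_hol`): for `f, f₃ ∈ holCotForms₂ … 𝔣` with square-integrable classes and `⟪[f],[f₃]⟫ = 0`,
`⟪R(ι_{w(ι)} u)[f], [f₃]⟫ = 0` for every `u ∈ U(σ_ι H)(ℂ)`.  Proof: ★ `E2ArchOrthHol.archOrth₂_of_frame` with the frame hypotheses of §1 and the
compactness of the automorphic quotient (`H` anisotropic). [cite: Liu2021, App. D Lem. D.2 (2)] [cite: BorelWallach2000, VII 3.2] -/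
theorem archOrthHol₂_holds :
    ∀ (L : Type) [Field L] [NumberField L] [IsCMField L] (ι : L →+* ℂ) (H : Matrix (Fin 2) (Fin 2) L)
    (dV : Fin 2 → L) (_hdV : ∀ i, IsCMField.complexConj L (dV i) = dV i) (_hdV0 : ∀ i, dV i ≠ 0)
    (t : L) (_ht : t ≠ 0) (g : GL (Fin 2) L),
    formCongr ((IsCMField.complexConj L : L ≃ₐ[↥(maximalRealSubfield L)] L) : L →+* L) g (t • H) = Matrix.diagonal dV →
    (∃ T : GL (Fin 2) ℂ, formCongr (starRingEnd ℂ) T ((Matrix.diagonal dV).map ι) = Matrix.diagonal ![(1 : ℂ), -1]) →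
    (∀ τ' : L →+* ℂ, InfinitePlace.mk τ' ≠ InfinitePlace.mk ι → ((Matrix.diagonal dV).map τ').PosDef) →
    4 ≤ Module.finrank ℚ L →
    ∀ (𝔣 : ConeFrame L H (cmPlace L ι))
      (μ : Measure (adelicGroupData (↥(maximalRealSubfield L)) L (IsCMField.complexConj L) 2 H).automorphicQuotient)
      [(adelicGroupData (↥(maximalRealSubfield L)) L (IsCMField.complexConj L) 2 H).IsAutomorphicMeasure μ]
      (f f₃ : (adelicGroupData (↥(maximalRealSubfield L)) L (IsCMField.complexConj L) 2 H).Adelic → ℂ),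
      f ∈ holCotForms₂ (↥(maximalRealSubfield L)) L (IsCMField.complexConj L) H (IsCMField.complexConj_ne_one L)
          (UnitaryGroup.complexConj_smul_infinitePlace L) (cmPlace L ι) 𝔣 →
      f₃ ∈ holCotForms₂ (↥(maximalRealSubfield L)) L (IsCMField.complexConj L) H (IsCMField.complexConj_ne_one L)
          (UnitaryGroup.complexConj_smul_infinitePlace L) (cmPlace L ι) 𝔣 →
    ∀ (hf : MemLp (toQuotFun (adelicGroupData (↥(maximalRealSubfield L)) L (IsCMField.complexConj L) 2 H) f) 2 μ)
      (h₃ : MemLp (toQuotFun (adelicGroupData (↥(maximalRealSubfield L)) L (IsCMField.complexConj L) 2 H) f₃) 2 μ),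
    ⟪MemLp.toLp (toQuotFun (adelicGroupData (↥(maximalRealSubfield L)) L (IsCMField.complexConj L) 2 H) f) hf,
      MemLp.toLp (toQuotFun (adelicGroupData (↥(maximalRealSubfield L)) L (IsCMField.complexConj L) 2 H) f₃) h₃⟫_ℂ = 0 →
    ∀ u : archLocal L 2 H (cmPlace L ι),
      ⟪(adelicGroupData (↥(maximalRealSubfield L)) L (IsCMField.complexConj L) 2 H).rightRegular μ
          (adelicSingle (↥(maximalRealSubfield L)) L (IsCMField.complexConj L) 2 H (IsCMField.complexConj_ne_one L)
            (UnitaryGroup.complexConj_smul_infinitePlace L) (cmPlace L ι) u)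
          (MemLp.toLp (toQuotFun (adelicGroupData (↥(maximalRealSubfield L)) L (IsCMField.complexConj L) 2 H) f) hf),
        MemLp.toLp (toQuotFun (adelicGroupData (↥(maximalRealSubfield L)) L (IsCMField.complexConj L) 2 H) f₃) h₃⟫_ℂ = 0 := by
  intro L _ _ _ ι H dV hdV _ t ht g hg _ hdef h4 𝔣 μ _ f f₃ hf hf₃ hfm h₃m h0 u
  -- compact quotient: `H` is anisotropic (definite at a complex place other than that of `ι`)
  obtain ⟨τ, hτ⟩ := UnitaryGroup.exists_infinitePlace_ne L h4 ι
  have hanis := S1BettiSliceExclusion.anisotropic_of_formCongr_posDef L H t g dV hg τ (hdef τ hτ)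
  haveI := UnitaryGroup.compactSpace_adelicGroupData_automorphicQuotient L 2 H hanis
  -- the two frame hypotheses
  obtain ⟨hvt, r, hr, hvv⟩ := frame_hypotheses ι H dV hdV t ht g hg 𝔣
  exact archOrth₂_of_frame hvt hr hvv hf hf₃ hfm h₃m h0 u

/-! ## §3 E₂ hinges on S3₂ alone -/

/-- **E₂-hol FROM S3₂ ALONE**: the body of ★ `UnitaryCurveForms.cohIsotypicLine₂_hol` from the admissibility cut `AdmissibleOfHolValuedType₂`
(`hadm`), S1 / S2⁺₂ / S2β₂ being kernel theorems (★ `stubS1_holds`, `archOrthHol₂_holds`, ★ `density₂_holds`).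
[cite: Liu2021, App. D Lem. D.2 (2)] [cite: BorelWallach2000, VI 4.11; VII 3.2] -/
theorem cohIsotypicLine₂_hol_of_admissible
    (hadm : ∀ (L : Type) [Field L] [NumberField L] [IsCMField L] (ι : L →+* ℂ) (H : Matrix (Fin 2) (Fin 2) L)
      (dV : Fin 2 → L) (_hdV : ∀ i, IsCMField.complexConj L (dV i) = dV i) (_hdV0 : ∀ i, dV i ≠ 0)
      (t : L) (_ht : t ≠ 0) (g : GL (Fin 2) L),
      formCongr ((IsCMField.complexConj L : L ≃ₐ[↥(maximalRealSubfield L)] L) : L →+* L) g (t • H) = Matrix.diagonal dV →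
      (∃ T : GL (Fin 2) ℂ, formCongr (starRingEnd ℂ) T ((Matrix.diagonal dV).map ι) = Matrix.diagonal ![(1 : ℂ), -1]) →
      (∀ τ' : L →+* ℂ, InfinitePlace.mk τ' ≠ InfinitePlace.mk ι → ((Matrix.diagonal dV).map τ').PosDef) →
      4 ≤ Module.finrank ℚ L →
      ∀ (𝔣 : ConeFrame L H (cmPlace L ι))
        (μ : Measure (adelicGroupData (↥(maximalRealSubfield L)) L (IsCMField.complexConj L) 2 H).automorphicQuotient)
        [(adelicGroupData (↥(maximalRealSubfield L)) L (IsCMField.complexConj L) 2 H).IsAutomorphicMeasure μ]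
        (P : DiscreteAutomorphicRep (adelicGroupData (↥(maximalRealSubfield L)) L (IsCMField.complexConj L) 2 H) μ)
        (W : Type) [AddCommGroup W] [Module ℂ W]
        (σ : Representation ℂ (finAdelic (↥(maximalRealSubfield L)) L (IsCMField.complexConj L) 2 H) W),
        σ.IsIrreducible → σ.IsSmooth →
      ∀ ψ : W →ₗ[ℂ] ((adelicGroupData (↥(maximalRealSubfield L)) L (IsCMField.complexConj L) 2 H).Adelic → ℂ),
        (∀ (k : finAdelic (↥(maximalRealSubfield L)) L (IsCMField.complexConj L) 2 H) (w : W),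
            ψ (σ k w) = rightRep₂ (↥(maximalRealSubfield L)) L (IsCMField.complexConj L) H k (ψ w)) →
        (∀ w : W, ψ w ∈ holCotForms₂ (↥(maximalRealSubfield L)) L (IsCMField.complexConj L) H (IsCMField.complexConj_ne_one L)
            (UnitaryGroup.complexConj_smul_infinitePlace L) (cmPlace L ι) 𝔣 ∧ P.ContainsFun (ψ w)) →
        ψ ≠ 0 → σ.IsAdmissible) :
    ∀ (L : Type) [Field L] [NumberField L] [IsCMField L] (ι : L →+* ℂ) (H : Matrix (Fin 2) (Fin 2) L)
    (dV : Fin 2 → L) (_hdV : ∀ i, IsCMField.complexConj L (dV i) = dV i) (_hdV0 : ∀ i, dV i ≠ 0)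
    (t : L) (_ht : t ≠ 0) (g : GL (Fin 2) L),
    formCongr ((IsCMField.complexConj L : L ≃ₐ[↥(maximalRealSubfield L)] L) : L →+* L) g (t • H) = Matrix.diagonal dV →
    (∃ T : GL (Fin 2) ℂ, formCongr (starRingEnd ℂ) T ((Matrix.diagonal dV).map ι) = Matrix.diagonal ![(1 : ℂ), -1]) →
    (∀ τ' : L →+* ℂ, InfinitePlace.mk τ' ≠ InfinitePlace.mk ι → ((Matrix.diagonal dV).map τ').PosDef) →
    4 ≤ Module.finrank ℚ L →
    ∀ (𝔣 : ConeFrame L H (cmPlace L ι))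
      (μ : Measure (adelicGroupData (↥(maximalRealSubfield L)) L (IsCMField.complexConj L) 2 H).automorphicQuotient)
      [(adelicGroupData (↥(maximalRealSubfield L)) L (IsCMField.complexConj L) 2 H).IsAutomorphicMeasure μ]
      (W : Type) [AddCommGroup W] [Module ℂ W]
      (σ : Representation ℂ (finAdelic (↥(maximalRealSubfield L)) L (IsCMField.complexConj L) 2 H) W),
      σ.IsIrreducible → σ.IsSmooth →
    ∀ P : DiscreteAutomorphicRep (adelicGroupData (↥(maximalRealSubfield L)) L (IsCMField.complexConj L) 2 H) μ,
      ∃ ψ₀ : W →ₗ[ℂ] ((adelicGroupData (↥(maximalRealSubfield L)) L (IsCMField.complexConj L) 2 H).Adelic → ℂ),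
        ∀ ψ : W →ₗ[ℂ] ((adelicGroupData (↥(maximalRealSubfield L)) L (IsCMField.complexConj L) 2 H).Adelic → ℂ),
          (∀ (g : finAdelic (↥(maximalRealSubfield L)) L (IsCMField.complexConj L) 2 H) (w : W),
              ψ (σ g w) = rightRep₂ (↥(maximalRealSubfield L)) L (IsCMField.complexConj L) H g (ψ w)) →
          (∀ w : W, ψ w ∈ holCotForms₂ (↥(maximalRealSubfield L)) L (IsCMField.complexConj L) H (IsCMField.complexConj_ne_one L)
              (UnitaryGroup.complexConj_smul_infinitePlace L) (cmPlace L ι) 𝔣 ∧ P.ContainsFun (ψ w)) →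
            ∃ r : ℂ, ψ = r • ψ₀ :=
  cohIsotypicLine₂_hol_of_cuts archOrthHol₂_holds hadm

end Summit.HodgeConjecture.HodgeConjecture.Cruxes.HLiu418.E2ArchOrthHolCM

end
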